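import Mathlib
import HarnessLib
import Summits.HubbardSuperconductivity.HubbardSuperconductivity.Theses.EnslavedA1g
import Summits.HubbardSuperconductivity.HubbardSuperconductivity.Theorems.EnslavedA1gIdentity
import Literature.MathematicalPhysics.QuantumLattice.HubbardCommutatorBound
import Literature.MathematicalPhysics.QuantumLattice.ApproximateEigenvectorLemmas
import Literature.MathematicalPhysics.QuantumLattice.HubbardWave0LiebProofs

/-!
# Route `EnslavedA1g`, support `A1gSlavingTransfer` (item `stmt-HubbardSuperconductivity-0935`)

ENSLAVEMENT TRANSFER: for every `U > 0`, every doping and every admissible sequence of normalised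
`(N_L, S^z = 0)`-sector ground states `ψ_L` of `hubbardTorus 2 L 1 U`, if the on-site pair-field
density `L⁻⁴ ‖P_s ψ_L‖²` tends to `0` along even `L` then so does the extended-`s` density
`L⁻⁴ ‖P_{s'} ψ_L‖²` (`a1gSlavingTransfer_proof`).

The proof given here is SHORTER than the route's sketch (no upper sandwich, no pair-chemical-
potential window, no Koma–Tasaki double commutator): it needs only

* the enslaved-A1g identity `2 P_{s'} = H P_s - P_s H + U P_s` (`L ≥ 3`), landed as
  `enslavedA1gIdentity_proof` (Zhang 1990 / Yang 1989);
* the eigenvalue equation `H ψ = E ψ` of a sector ground state and `H = Hᴴ`;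
* a SINGLE-commutator locality bound `‖[H, P_{s'}]‖ ≤ K · L²` (the tree's volume-independent
  `‖[H, c_{xσ}]‖ ≤ 18 (2 + |U|)`, `norm_commutator_hubbardTorusWith_annihilation_le`, summed over
  the `5 L²` bond terms of the pair field).

Indeed, with `a = P_{s'}ψ`, `b = P_sψ`: `2a = (H - E + U) b`, so
`2‖a‖² = ⟨a, (H - E) b⟩ + U⟨a, b⟩ = ⟨(H - E) a, b⟩ + U⟨a, b⟩ = ⟨[H, P_{s'}]ψ, b⟩ + U⟨a, b⟩`, whence
`2‖a‖² ≤ K L² ‖b‖ + |U| ‖a‖ ‖b‖ ≤ K L² ‖b‖ + ‖a‖² + U² ‖b‖² / 4`; in densities `x = ‖a‖²/L⁴`,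
`y = ‖b‖²/L⁴` this reads `x ≤ K √y + U² y / 4`, and `y → 0` forces `x → 0`.

Sources: S.-C. Zhang, PRL 65 (1990) 120; C. N. Yang, PRL 63 (1989) 2144; G.-S. Tian, J. Phys. A 27
(1994) 6677 (the commutator/Schwarz-inequality method relating on-site and extended-s pairing order);
M. B. Hastings, T. Koma, CMP 265 (2006) 781, App. A (locality of commutators with local terms).
-/

noncomputable section

namespace Summit.HubbardSuperconductivity.EnslavedA1g

open Matrix Finset
open scoped Matrix.Norms.L2Operator ComplexOrder
open Literature.Probability.LatticeModels Literature.MathematicalPhysics.QuantumLattice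
open Summit.HubbardSuperconductivity.HubbardSuperconductivity.Theses.EnslavedA1g

/-! ### Linear algebra: the slaving inequality for an eigenvector -/

section LinearAlgebra

variable {n : Type*} [Fintype n] [DecidableEq n]

omit [DecidableEq n] in
/-- `Re ⟨ψ, Pᴴ P ψ⟩ = ‖P ψ‖₂²`. [folklore] -/
theorem re_star_dotProduct_conjTranspose_mul_self_mulVec (P : Matrix n n ℂ) (ψ : n → ℂ) :
    (star ψ ⬝ᵥ ((Pᴴ * P) *ᵥ ψ)).re = eucNorm (P *ᵥ ψ) ^ 2 := by
  rw [← mulVec_mulVec, dotProduct_mulVec, ← star_mulVec, star_dotProduct_self_eq_eucNorm_sq,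
    Complex.ofReal_re]

omit [DecidableEq n] in
/-- For a Hermitian `H`: `⟨a, H b⟩ = ⟨H a, b⟩` in the `dotProduct` language. [folklore] -/
theorem star_dotProduct_mulVec_of_isHermitian {H : Matrix n n ℂ} (hH : H.IsHermitian) (a b : n → ℂ) :
    star a ⬝ᵥ (H *ᵥ b) = star (H *ᵥ a) ⬝ᵥ b := by
  rw [dotProduct_mulVec, star_mulVec, hH.eq]

/-- **The slaving inequality.** If `2 • Pe = H Ps - Ps H + U • Ps` with `H` Hermitian and
`H ψ = E ψ` (`E` real, `ψ` a unit vector), then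
`2 ‖Pe ψ‖² ≤ ‖H Pe - Pe H‖ · ‖Ps ψ‖ + |U| · ‖Pe ψ‖ · ‖Ps ψ‖`:
`2‖a‖² = ⟨[H, Pe]ψ, b⟩ + U⟨a, b⟩` for `a = Pe ψ`, `b = Ps ψ`. Tian, J. Phys. A 27 (1994) 6677
(commutator method); Zhang, PRL 65 (1990) 120. [folklore] -/
theorem two_mul_eucNorm_sq_le_of_slaving {H Ps Pe : Matrix n n ℂ} (hH : H.IsHermitian) {U E : ℝ}
    (hId : (2 : ℂ) • Pe = H * Ps - Ps * H + (U : ℂ) • Ps) {ψ : n → ℂ} (hψ1 : star ψ ⬝ᵥ ψ = 1)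
    (hHψ : H *ᵥ ψ = (E : ℂ) • ψ) :
    2 * eucNorm (Pe *ᵥ ψ) ^ 2 ≤
      ‖H * Pe - Pe * H‖ * eucNorm (Ps *ᵥ ψ) + |U| * eucNorm (Pe *ᵥ ψ) * eucNorm (Ps *ᵥ ψ) := by
  set a : n → ℂ := Pe *ᵥ ψ with ha
  set b : n → ℂ := Ps *ᵥ ψ with hb
  set C : Matrix n n ℂ := H * Pe - Pe * H with hC
  -- `2a = H b - E b + U b`
  have h2a : (2 : ℂ) • a = H *ᵥ b - (E : ℂ) • b + (U : ℂ) • b := by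
    have h := congrArg (fun M : Matrix n n ℂ => M *ᵥ ψ) hId
    simp only [smul_mulVec, add_mulVec, sub_mulVec, ← mulVec_mulVec, hHψ, mulVec_smul] at h
    rw [ha, hb, h]
  -- `H a = C ψ + E a`
  have hHa : H *ᵥ a = C *ᵥ ψ + (E : ℂ) • a := by
    rw [hC, sub_mulVec, ← mulVec_mulVec, ← mulVec_mulVec, hHψ, mulVec_smul, ha, sub_add_cancel]
  -- the identity `2⟨a,a⟩ = ⟨Cψ, b⟩ + U⟨a, b⟩`
  have hkey : (2 : ℂ) * (star a ⬝ᵥ a) = star (C *ᵥ ψ) ⬝ᵥ b + (U : ℂ) * (star a ⬝ᵥ b) := by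
    have h1 : star a ⬝ᵥ ((2 : ℂ) • a) = (2 : ℂ) * (star a ⬝ᵥ a) := by
      rw [dotProduct_smul, smul_eq_mul]
    rw [← h1, h2a, dotProduct_add, dotProduct_sub, dotProduct_smul, dotProduct_smul,
      star_dotProduct_mulVec_of_isHermitian hH, hHa, star_add, star_smul, add_dotProduct,
      smul_dotProduct, Complex.star_def, Complex.conj_ofReal]
    simp only [smul_eq_mul]
    ring
  -- norms
  have hA : star a ⬝ᵥ a = ((eucNorm a ^ 2 : ℝ) : ℂ) := star_dotProduct_self_eq_eucNorm_sq a
  have hlhs : ‖(2 : ℂ) * (star a ⬝ᵥ a)‖ = 2 * eucNorm a ^ 2 := by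
    rw [hA, norm_mul, Complex.norm_ofNat, Complex.norm_real, Real.norm_eq_abs,
      abs_of_nonneg (sq_nonneg _)]
  have h1 : ‖star (C *ᵥ ψ) ⬝ᵥ b‖ ≤ ‖C‖ * eucNorm b := by
    refine (norm_star_dotProduct_le _ _).trans ?_
    have hCψ : eucNorm (C *ᵥ ψ) ≤ ‖C‖ := by
      have h := eucNorm_mulVec_le C ψ
      rwa [eucNorm_eq_one hψ1, mul_one] at h
    exact mul_le_mul_of_nonneg_right hCψ (eucNorm_nonneg _)
  have h2 : ‖(U : ℂ) * (star a ⬝ᵥ b)‖ ≤ |U| * eucNorm a * eucNorm b := by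
    rw [norm_mul, Complex.norm_real, Real.norm_eq_abs, mul_assoc]
    exact mul_le_mul_of_nonneg_left (norm_star_dotProduct_le _ _) (abs_nonneg _)
  calc 2 * eucNorm a ^ 2 = ‖(2 : ℂ) * (star a ⬝ᵥ a)‖ := hlhs.symm
    _ = ‖star (C *ᵥ ψ) ⬝ᵥ b + (U : ℂ) * (star a ⬝ᵥ b)‖ := by rw [hkey]
    _ ≤ ‖star (C *ᵥ ψ) ⬝ᵥ b‖ + ‖(U : ℂ) * (star a ⬝ᵥ b)‖ := norm_add_le _ _
    _ ≤ ‖C‖ * eucNorm b + |U| * eucNorm a * eucNorm b := add_le_add h1 h2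

/-- AM–GM step: `2x² ≤ K B + V x B` implies `x² ≤ K B + V² B² / 4`. [folklore] -/
theorem sq_le_of_two_mul_sq_le {x B K V : ℝ} (h : 2 * x ^ 2 ≤ K * B + V * x * B) :
    x ^ 2 ≤ K * B + V ^ 2 * B ^ 2 / 4 := by
  nlinarith [sq_nonneg (x - V * B / 2)]

end LinearAlgebra

/-! ### Locality: `‖[H, Δ_g]‖ = O(L²)` -/

section Commutator

/-- `[H, ab] = [H, a] b + a [H, b]`. [folklore] -/
theorem commutator_mul_derivation {R : Type*} [Ring R] (H a b : R) :
    H * (a * b) - a * b * H = (H * a - a * H) * b + a * (H * b - b * H) := by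
  noncomm_ring

/-- `‖[H, A - B]‖ ≤ ‖[H, A]‖ + ‖[H, B]‖`. [folklore] -/
theorem norm_commutator_sub_le {R : Type*} [NormedRing R] (H A B : R) :
    ‖H * (A - B) - (A - B) * H‖ ≤ ‖H * A - A * H‖ + ‖H * B - B * H‖ := by
  calc ‖H * (A - B) - (A - B) * H‖ = ‖(H * A - A * H) - (H * B - B * H)‖ := by
        congr 1; noncomm_ring
    _ ≤ _ := norm_sub_le _ _

/-- `[H, c • A] = c • [H, A]`. [folklore] -/
theorem commutator_smul {R : Type*} [Ring R] [Algebra ℂ R] (c : ℂ) (H A : R) :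
    H * (c • A) - c • A * H = c • (H * A - A * H) := by
  rw [mul_smul_comm, smul_mul_assoc, smul_sub]

/-- `[H, Σ f] = Σ [H, f]`. [folklore] -/
theorem commutator_sum {R : Type*} [Ring R] {ι : Type*} (s : Finset ι) (H : R) (f : ι → R) :
    H * (∑ i ∈ s, f i) - (∑ i ∈ s, f i) * H = ∑ i ∈ s, (H * f i - f i * H) := by
  rw [Finset.mul_sum, Finset.sum_mul, ← Finset.sum_sub_distrib]

variable {L : ℕ} [NeZero L]

/-- `‖[H(1,U), c_{vσ}]‖ ≤ 18 (2 + |U|)` on the torus `(ℤ/Lℤ)²`, uniformly in `L` (the `μ = 0` case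
of the tree's `norm_commutator_hubbardTorusWith_annihilation_le`). Hastings–Koma, CMP 265 (2006)
781, App. A. [folklore] -/
theorem norm_commutator_hubbardTorus_annihilation_le (U : ℝ) (v : FermionTorus 2 L) (σ : Fin 2) :
    ‖hubbardTorus 2 L 1 U * annihilation (orb v σ) - annihilation (orb v σ) * hubbardTorus 2 L 1 U‖ ≤
      18 * (2 + |U|) := by
  have h := norm_commutator_hubbardTorusWith_annihilation_le U 0 L v σ
  rw [hubbardTorusWith_zero, abs_zero, mul_zero, add_zero] at h
  exact h

/-- `‖[H(1,U), c_{vσ} c_{wτ}]‖ ≤ 36 (2 + |U|)` (derivation property and `‖c‖ ≤ 1`).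
Hastings–Koma, CMP 265 (2006) 781, App. A. [folklore] -/
theorem norm_commutator_hubbardTorus_annihilation_mul_le (U : ℝ) (v w : FermionTorus 2 L)
    (σ τ : Fin 2) :
    ‖hubbardTorus 2 L 1 U * (annihilation (orb v σ) * annihilation (orb w τ)) -
        annihilation (orb v σ) * annihilation (orb w τ) * hubbardTorus 2 L 1 U‖ ≤ 36 * (2 + |U|) := by
  rw [commutator_mul_derivation]
  have h1 := norm_commutator_hubbardTorus_annihilation_le (L := L) U v σ
  have h2 := norm_commutator_hubbardTorus_annihilation_le (L := L) U w τ
  have ha := norm_annihilation_le_one (ι := Orb (FermionTorus 2 L)) (orb v σ)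
  have hb := norm_annihilation_le_one (ι := Orb (FermionTorus 2 L)) (orb w τ)
  have hU : 0 ≤ 18 * (2 + |U|) := by positivity
  calc _ ≤ ‖(hubbardTorus 2 L 1 U * annihilation (orb v σ) -
              annihilation (orb v σ) * hubbardTorus 2 L 1 U) * annihilation (orb w τ)‖ +
          ‖annihilation (orb v σ) * (hubbardTorus 2 L 1 U * annihilation (orb w τ) -
              annihilation (orb w τ) * hubbardTorus 2 L 1 U)‖ := norm_add_le _ _
    _ ≤ ‖hubbardTorus 2 L 1 U * annihilation (orb v σ) -
              annihilation (orb v σ) * hubbardTorus 2 L 1 U‖ *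
            ‖(annihilation (orb w τ) : Matrix (Finset (Orb (FermionTorus 2 L))) _ ℂ)‖ +
          ‖(annihilation (orb v σ) : Matrix (Finset (Orb (FermionTorus 2 L))) _ ℂ)‖ *
            ‖hubbardTorus 2 L 1 U * annihilation (orb w τ) -
              annihilation (orb w τ) * hubbardTorus 2 L 1 U‖ :=
        add_le_add (norm_mul_le _ _) (norm_mul_le _ _)
    _ ≤ 18 * (2 + |U|) * 1 + 1 * (18 * (2 + |U|)) :=
        add_le_add (mul_le_mul h1 hb (norm_nonneg _) hU) (mul_le_mul ha h2 (norm_nonneg _) zero_le_one)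
    _ = 36 * (2 + |U|) := by ring

/-- `‖[H(1,U), P_x]‖ ≤ (Σ_e |g e|/√2) · 72 (2 + |U|)` for the local pair operator `P_x = localPair g L x`
(a combination of `c_{x↑} c_{x+e,↓} - c_{x↓} c_{x+e,↑}` over the five steps `e`).
Hastings–Koma, CMP 265 (2006) 781, App. A. [folklore] -/
theorem norm_commutator_hubbardTorus_localPair_le (g : Site 2 → ℝ) (U : ℝ) (x : TorusSite 2 L) :
    ‖hubbardTorus 2 L 1 U * localPair g L x - localPair g L x * hubbardTorus 2 L 1 U‖ ≤
      (∑ e ∈ insert 0 unitSteps, ‖((g e / Real.sqrt 2 : ℝ) : ℂ)‖) * (72 * (2 + |U|)) := by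
  unfold localPair
  rw [commutator_sum, Finset.sum_mul]
  refine (norm_sum_le _ _).trans (Finset.sum_le_sum fun e _ => ?_)
  rw [commutator_smul, norm_smul]
  refine mul_le_mul_of_nonneg_left ?_ (norm_nonneg _)
  refine (norm_commutator_sub_le _ _ _).trans ?_
  have h1 := norm_commutator_hubbardTorus_annihilation_mul_le (L := L) U (FermionTorus.ofTorusSite x)
    (FermionTorus.ofTorusSite (x + Torus.proj L e)) 0 1
  have h2 := norm_commutator_hubbardTorus_annihilation_mul_le (L := L) U (FermionTorus.ofTorusSite x)
    (FermionTorus.ofTorusSite (x + Torus.proj L e)) 1 0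
  linarith

/-- **Single-commutator locality bound for the pair field**:
`‖[H(1,U), Δ_g]‖ ≤ (Σ_e |g e|/√2) · 72 (2 + |U|) · L²` on the torus of side `L` (`L²` local pair
operators, each failing to commute with `O(1)` terms of `H`). Hastings–Koma, CMP 265 (2006) 781,
App. A; Tian, J. Phys. A 27 (1994) 6677. [folklore] -/
theorem norm_commutator_hubbardTorus_pairField_le (g : Site 2 → ℝ) (U : ℝ) (L : ℕ) [NeZero L] :
    ‖hubbardTorus 2 L 1 U * pairField g L - pairField g L * hubbardTorus 2 L 1 U‖ ≤
      (∑ e ∈ insert 0 unitSteps, ‖((g e / Real.sqrt 2 : ℝ) : ℂ)‖) * (72 * (2 + |U|)) * (L : ℝ) ^ 2 := by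
  unfold pairField
  rw [commutator_sum]
  refine (norm_sum_le _ _).trans ?_
  calc ∑ x : TorusSite 2 L, ‖hubbardTorus 2 L 1 U * localPair g L x - localPair g L x * hubbardTorus 2 L 1 U‖
      ≤ ∑ _x : TorusSite 2 L, (∑ e ∈ insert 0 unitSteps, ‖((g e / Real.sqrt 2 : ℝ) : ℂ)‖) * (72 * (2 + |U|)) :=
        Finset.sum_le_sum fun x _ => norm_commutator_hubbardTorus_localPair_le g U x
    _ = _ := by
        rw [Finset.sum_const, Finset.card_univ, Fintype.card_fun, ZMod.card, Fintype.card_fin,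
          nsmul_eq_mul]
        push_cast
        ring

/-- The locality bound with the constant packaged: `∃ K ≥ 0, ∀ L, ‖[H_L, Δ_g]‖ ≤ K L²`. [folklore] -/
theorem exists_norm_commutator_hubbardTorus_pairField_le (g : Site 2 → ℝ) (U : ℝ) :
    ∃ K : ℝ, 0 ≤ K ∧ ∀ (L : ℕ) [NeZero L],
      ‖hubbardTorus 2 L 1 U * pairField g L - pairField g L * hubbardTorus 2 L 1 U‖ ≤ K * (L : ℝ) ^ 2 :=
  ⟨(∑ e ∈ insert 0 unitSteps, ‖((g e / Real.sqrt 2 : ℝ) : ℂ)‖) * (72 * (2 + |U|)),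
    mul_nonneg (Finset.sum_nonneg fun _ _ => norm_nonneg _) (by positivity),
    fun L _ => norm_commutator_hubbardTorus_pairField_le g U L⟩

end Commutator

/-! ### The transfer -/

section Transfer

/-- **`A1gSlavingTransfer` (route `EnslavedA1g`, item 0935).** For every `U > 0`, `δ ∈ (0, 1/2)`
and every admissible sequence of normalised `(N_L, S^z = 0)`-sector ground states of
`hubbardTorus 2 L 1 U`: if the on-site pair-field density `L⁻⁴ Re⟨ψ_L, P_s† P_s ψ_L⟩ → 0` along
even `L`, then the extended-`s` density `L⁻⁴ Re⟨ψ_L, P_{s'}† P_{s'} ψ_L⟩ → 0` along even `L`.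
Proof: the slaving inequality `2‖P_{s'}ψ‖² ≤ ‖[H, P_{s'}]‖ ‖P_sψ‖ + |U| ‖P_{s'}ψ‖ ‖P_sψ‖`
(`two_mul_eucNorm_sq_le_of_slaving`, from `enslavedA1gIdentity_proof` and `Hψ = Eψ`) and the
locality bound `‖[H, P_{s'}]‖ ≤ K L²` give, in densities, `x ≤ K √y + U² y / 4`.
Zhang, PRL 65 (1990) 120; Yang, PRL 63 (1989) 2144; Tian, J. Phys. A 27 (1994) 6677. [folklore] -/
theorem a1gSlavingTransfer_proof : A1gSlavingTransfer := by
  intro U δ _hU _hδ N ψ hadm hons ε hε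
  -- the commutator constant `K` and the tolerance `t` for the on-site density
  obtain ⟨K, hK0, hK⟩ := exists_norm_commutator_hubbardTorus_pairField_le extendedSWave U
  have hMpos : 0 < K + U ^ 2 / 4 + 1 := by positivity
  obtain ⟨t, htpos, ht1, htM⟩ : ∃ t : ℝ, 0 < t ∧ t ≤ 1 ∧ t ≤ ε / (K + U ^ 2 / 4 + 1) :=
    ⟨min 1 (ε / (K + U ^ 2 / 4 + 1)), lt_min one_pos (div_pos hε hMpos), min_le_left _ _,
      min_le_right _ _⟩
  obtain ⟨L₀, hL₀⟩ := hons (t ^ 2) (by positivity)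
  refine ⟨max L₀ 3, fun L _ hLeven hL => ?_⟩
  have hL3 : 2 < L := lt_of_lt_of_le (by norm_num) ((le_max_right L₀ 3).trans hL)
  obtain ⟨-, hnorm, hGS⟩ := hadm L hLeven
  have hy := hL₀ L hLeven ((le_max_left L₀ 3).trans hL)
  -- the players
  have hHerm : (hubbardTorus 2 L 1 U).IsHermitian :=
    hubbardTorus_isHermitian (hamiltonian_isHermitian_and_commute_holds _) 1 U
  have hId := enslavedA1gIdentity_proof L hL3 U
  have hkey := two_mul_eucNorm_sq_le_of_slaving hHerm hId hnorm hGS.2.2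
  have hcomm := hK L
  -- rewrite the densities as squared Euclidean norms
  have hA2 : (expect ((pairField extendedSWave L)ᴴ * pairField extendedSWave L) (ψ L)).re =
      eucNorm (pairField extendedSWave L *ᵥ ψ L) ^ 2 :=
    re_star_dotProduct_conjTranspose_mul_self_mulVec _ _
  have hB2 : (expect ((pairField sWave L)ᴴ * pairField sWave L) (ψ L)).re =
      eucNorm (pairField sWave L *ᵥ ψ L) ^ 2 :=
    re_star_dotProduct_conjTranspose_mul_self_mulVec _ _
  rw [hA2]
  rw [hB2] at hy
  set A : ℝ := eucNorm (pairField extendedSWave L *ᵥ ψ L) with hA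
  set B : ℝ := eucNorm (pairField sWave L *ᵥ ψ L) with hB
  have hA0 : 0 ≤ A := eucNorm_nonneg _
  have hB0 : 0 ≤ B := eucNorm_nonneg _
  -- the side as a real number
  have hLpos : (0 : ℝ) < L := by exact_mod_cast (lt_trans (by norm_num) hL3 : 0 < L)
  set ℓ : ℝ := (L : ℝ) ^ 2 with hℓ
  have hℓpos : 0 < ℓ := by positivity
  have hL4 : (L : ℝ) ^ 4 = ℓ ^ 2 := by rw [hℓ]; ring
  rw [hL4] at hy ⊢
  -- `B ≤ t ℓ`
  have hBsq : B ^ 2 ≤ (t * ℓ) ^ 2 := by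
    rw [div_le_iff₀ (by positivity)] at hy
    nlinarith [hy]
  have hBt : B ≤ t * ℓ := (sq_le_sq₀ hB0 (by positivity)).1 hBsq
  -- `2A² ≤ K ℓ B + |U| A B`, hence `A² ≤ K ℓ B + U² B² / 4`
  have h2A : 2 * A ^ 2 ≤ K * ℓ * B + |U| * A * B := by
    exact hkey.trans (add_le_add (mul_le_mul_of_nonneg_right hcomm hB0) le_rfl)
  have hA2le : A ^ 2 ≤ K * ℓ * B + U ^ 2 * B ^ 2 / 4 := by
    have h := sq_le_of_two_mul_sq_le h2A
    rwa [sq_abs] at h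
  -- conclude
  rw [div_le_iff₀ (by positivity)]
  have ht2 : t ^ 2 ≤ t := by nlinarith
  have hKU : (K + U ^ 2 / 4) * t ≤ ε := by
    calc (K + U ^ 2 / 4) * t ≤ (K + U ^ 2 / 4) * (ε / (K + U ^ 2 / 4 + 1)) :=
          mul_le_mul_of_nonneg_left htM (by positivity)
      _ ≤ (K + U ^ 2 / 4 + 1) * (ε / (K + U ^ 2 / 4 + 1)) :=
          mul_le_mul_of_nonneg_right (by linarith) (div_nonneg hε.le hMpos.le)
      _ = ε := mul_div_cancel₀ ε hMpos.ne'
  calc A ^ 2 ≤ K * ℓ * B + U ^ 2 * B ^ 2 / 4 := hA2le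
    _ ≤ K * ℓ * (t * ℓ) + U ^ 2 * (t * ℓ) ^ 2 / 4 := by gcongr
    _ = (K * t + U ^ 2 / 4 * t ^ 2) * ℓ ^ 2 := by ring
    _ ≤ (K * t + U ^ 2 / 4 * t) * ℓ ^ 2 := by gcongr
    _ = (K + U ^ 2 / 4) * t * ℓ ^ 2 := by ring
    _ ≤ ε * ℓ ^ 2 := mul_le_mul_of_nonneg_right hKU (by positivity)

end Transfer

end Summit.HubbardSuperconductivity.EnslavedA1g

end
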